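import Literature.NumberTheory.GaloisRepresentations.LubinTateColemanLogDeriv
import Literature.NumberTheory.GaloisRepresentations.LubinTateColemanTorsion
import Literature.NumberTheory.GaloisRepresentations.LubinTateColemanGalois
import HarnessLib

/-!
# Coleman's logarithmic derivative on the norm-coherent units `𝒰`, and its kernel

De Shalit, *Iwasawa theory of elliptic curves with complex multiplication* (1987), Ch. I §3.4 (Lemma:
`μ_{ββ'} = μ_β + μ_{β'}`, `μ_{γβ}(γU) = μ_β(U)`), §3.5 (ii), §3.12 (Corollary: "`δ` maps `{𝒩g = g^φ}`
onto `{𝒮h = h^φ}`; its kernel consists of the roots of unity in `𝒪'`").  For `f = πX + X^q` over the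
valuation ring of any non-archimedean local field `F` (absolute case), with `δ = logDeriv hπ`
(`LubinTateColemanLogDeriv.lean`: `δg = ω_F · g'/g`, `𝒮(δg) = π · δ(𝒩g)`) and Coleman's bijection
`𝒰 ≅ ℳ_f`, `β ↦ g_β` (`LubinTateColemanSeries/Equiv/Galois.lean`), this file PROVES:

* kernel of `δ`: `logDeriv_eq_zero_iff` (`δg = 0 ↔ g' = 0`); in characteristic `0`
  (`isAddTorsionFree_LTCoeff`): `eq_C_of_logDeriv_eq_zero` (`δg = 0 ⟹ g` constant), `eq_of_logDeriv_eq`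
  (`δg = δh`, `g(0) = h(0) ⟹ g = h`), ★ `eq_C_of_colemanNorm_eq_of_logDeriv_eq_zero`
  (`𝒩g = g`, `δg = 0 ⟹ g = C(c)`, `c^q = c`: **the kernel of `δ` on `ℳ_f` is `μ_{q-1}`**);
* `δ` on `𝒰`: `NormCoherentUnits.colemanUnit` (`g_β` as a unit), `NormCoherentUnits.logDeriv β = δ g_β` with
  ★ `NormCoherentUnits.colemanTrace_logDeriv` (**`𝒮(δβ) = π · δβ`**), `logDeriv_mul` / `logDeriv_one`
  (**`δ(ββ') = δβ + δβ'`**), ★ `logDeriv_unitAct` / `logDeriv_galAct`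
  (**`δ(σβ) = χ_π(σ) · (δβ) ∘ [χ_π(σ)]_f`**), ★ `exists_eq_algebraMap_of_logDeriv_eq_zero`
  (**`δβ = 0 ⟹ β` is the constant sequence of a root of unity `c ∈ μ_{q-1}`**, characteristic `0`).

Everything here is proved (0 sorry).

## References

* E. de Shalit, *Iwasawa theory of elliptic curves with complex multiplication* (1987), Ch. I §3.4
  Lemma, §3.5, §3.12 Corollary. [deShalit1987]
* R. Coleman, *Division values in local fields*, Invent. Math. 53 (1979). [Coleman1979]
-/

noncomputable section

open Filter Topology
open scoped PowerSeries.WithPiTopology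

/-! ## The kernel of `δ`, and `δ` on Coleman's norm-coherent units `𝒰` -/

namespace Literature.NumberTheory.GaloisRepresentations

section LocalFieldLogDerivUnits

open GaloisRepresentations.IsNonarchimedeanLocalField LubinTate ValuativeRel

variable (F : Type*) [Field F] [ValuativeRel F] [TopologicalSpace F] [IsNonarchimedeanLocalField F]

attribute [local instance] ltNormUniformSpace ltNormIsUniformAddGroup rk1 nF nE fintypeResidueField

variable {F}
variable {π : 𝒪[F]} (hπ : (valuation F).IsUniformizer (π : F)) (n : ℕ)

/-! ### The kernel of Coleman's logarithmic derivative -/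

/-- `δg = 0 ↔ g' = 0` (`ω_F` and `g` are units). [cite: deShalit1987, Ch. I §3.12 Corollary] -/
theorem logDeriv_eq_zero_iff (g : (PowerSeries (LTCoeff F))ˣ) :
    logDeriv hπ g = 0 ↔ PowerSeries.derivative (LTCoeff F) (g : PowerSeries (LTCoeff F)) = 0 := by
  rw [logDeriv, (isUnit_invDiff _ _).mul_right_eq_zero, PowerSeries.dlog_def, Units.mul_left_eq_zero]

omit [TopologicalSpace F] [IsNonarchimedeanLocalField F] in
/-- `𝒪[F]` (through its discrete copy `LTCoeff F`) is additively torsion-free in characteristic `0`.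
[cite: deShalit1987, Ch. I §3.12 Corollary] -/
theorem isAddTorsionFree_LTCoeff [CharZero F] : IsAddTorsionFree (LTCoeff F) := by
  haveI : IsDomain (LTCoeff F) := inferInstanceAs (IsDomain 𝒪[F])
  haveI : CharZero (LTCoeff F) := inferInstanceAs (CharZero 𝒪[F])
  infer_instance

/-- **`δg = 0 ⟹ g` is a constant** (characteristic `0`). [cite: deShalit1987, Ch. I §3.12 Corollary] -/
theorem eq_C_of_logDeriv_eq_zero [CharZero F] (g : (PowerSeries (LTCoeff F))ˣ) (h : logDeriv hπ g = 0) :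
    (g : PowerSeries (LTCoeff F)) = PowerSeries.C (PowerSeries.constantCoeff (g : PowerSeries (LTCoeff F))) := by
  haveI := isAddTorsionFree_LTCoeff (F := F)
  refine PowerSeries.derivative.ext ?_ (by rw [PowerSeries.constantCoeff_C])
  rw [(logDeriv_eq_zero_iff hπ g).mp h, PowerSeries.derivative_C]

/-- **`δ` is injective up to the constant term**: `δg = δh` and `g(0) = h(0)` imply `g = h`
(characteristic `0`). [cite: deShalit1987, Ch. I §3.12 Corollary] -/
theorem eq_of_logDeriv_eq [CharZero F] (g h : (PowerSeries (LTCoeff F))ˣ) (hδ : logDeriv hπ g = logDeriv hπ h)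
    (h0 : PowerSeries.constantCoeff (g : PowerSeries (LTCoeff F)) =
      PowerSeries.constantCoeff (h : PowerSeries (LTCoeff F))) : g = h := by
  -- `δ(g h⁻¹) = 0`, so `g h⁻¹` is the constant `g(0) h(0)⁻¹ = 1`
  have hinv : logDeriv hπ h⁻¹ = -logDeriv hπ h := by
    rw [eq_neg_iff_add_eq_zero, add_comm, ← logDeriv_mul, mul_inv_cancel, logDeriv_one]
  have hu : logDeriv hπ (g * h⁻¹) = 0 := by rw [logDeriv_mul, hinv, hδ, add_neg_cancel]
  have hC := eq_C_of_logDeriv_eq_zero hπ _ hu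
  have hc : PowerSeries.constantCoeff ((g * h⁻¹ : (PowerSeries (LTCoeff F))ˣ) : PowerSeries (LTCoeff F)) = 1 := by
    rw [Units.val_mul, map_mul, h0, ← map_mul, Units.mul_inv, map_one]
  rw [hc, map_one] at hC
  exact mul_inv_eq_one.mp (Units.ext hC)

/-- ★ **The kernel of `δ` on the `𝒩`-invariant units is `μ_{q-1}`**: if `𝒩g = g` and `δg = 0` then
`g = C(c)` with `c^q = c` (de Shalit I §3.12 Corollary: "its kernel consists of the roots of unity in `𝒪'`";
characteristic `0`). [cite: deShalit1987, Ch. I §3.12 Corollary] -/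
theorem eq_C_of_colemanNorm_eq_of_logDeriv_eq_zero [CharZero F] (g : (PowerSeries (LTCoeff F))ˣ)
    (hN : colemanNorm hπ n (g : PowerSeries (LTCoeff F)) = g) (hδ : logDeriv hπ g = 0) :
    (g : PowerSeries (LTCoeff F)) = PowerSeries.C (PowerSeries.constantCoeff (g : PowerSeries (LTCoeff F))) ∧
      PowerSeries.constantCoeff (g : PowerSeries (LTCoeff F)) ^ residueFieldCard F =
        PowerSeries.constantCoeff (g : PowerSeries (LTCoeff F)) := by
  have hC := eq_C_of_logDeriv_eq_zero hπ g hδ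
  refine ⟨hC, ?_⟩
  have h1 := hN
  rw [hC, colemanNorm_C] at h1
  have h2 := congrArg PowerSeries.constantCoeff h1
  rwa [PowerSeries.constantCoeff_C, PowerSeries.constantCoeff_C] at h2

/-! ### `δ` on the norm-coherent units `𝒰 = lim← U(K_π^{m+1})` -/

namespace NormCoherentUnits

variable {hπ}

/-- The Coleman power series `g_β` as a unit of `𝒪[F]⟦X⟧`. [cite: deShalit1987, Ch. I §2.2 Theorem] -/
def colemanUnit (β : NormCoherentUnits hπ) : (PowerSeries (LTCoeff F))ˣ := (isUnit_colemanSeries hπ β).unit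

/-- Its underlying series is `g_β`. [cite: deShalit1987, Ch. I §2.2 Theorem] -/
@[simp] theorem coe_colemanUnit (β : NormCoherentUnits hπ) :
    ((colemanUnit β : (PowerSeries (LTCoeff F))ˣ) : PowerSeries (LTCoeff F)) = colemanSeries hπ β :=
  (isUnit_colemanSeries hπ β).unit_spec

/-- `g_{ββ'} = g_β g_{β'}` as units. [cite: deShalit1987, Ch. I §2.3 (i)] -/
theorem colemanUnit_mul (β β' : NormCoherentUnits hπ) : colemanUnit (β.mul β') = colemanUnit β * colemanUnit β' :=
  Units.ext (by rw [coe_colemanUnit, Units.val_mul, coe_colemanUnit, coe_colemanUnit, colemanSeries_mul])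

/-- `g_1 = 1` as units. [cite: deShalit1987, Ch. I §2.3 (i)] -/
theorem colemanUnit_one : colemanUnit (one : NormCoherentUnits hπ) = 1 :=
  Units.ext (by rw [coe_colemanUnit, Units.val_one, colemanSeries_one])

/-- **Coleman's logarithmic derivative `δβ := δ g_β = ω_F · g_β'/g_β` of a norm-coherent unit `β ∈ 𝒰`**
(the power series whose twist by `ω_F`-moments gives de Shalit's measure `μ_β`, I §3.4–3.5 (11)).
[cite: deShalit1987, Ch. I §3.5] -/
def logDeriv (β : NormCoherentUnits hπ) : PowerSeries (LTCoeff F) :=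
  GaloisRepresentations.logDeriv hπ (colemanUnit β)

/-- Unfolding. [cite: deShalit1987, Ch. I §3.5] -/
theorem logDeriv_def (β : NormCoherentUnits hπ) :
    β.logDeriv = GaloisRepresentations.logDeriv hπ (colemanUnit β) := rfl

/-- ★ **`𝒮(δβ) = π · δβ`** for every `β ∈ 𝒰` (as `𝒩 g_β = g_β`): `δ` maps `𝒰` into the `𝒮`-eigenseries
`ℰ_π = {h ∈ 𝒪[F]⟦X⟧ : 𝒮h = πh}`. [cite: deShalit1987, Ch. I §3.12 Corollary] -/
theorem colemanTrace_logDeriv (β : NormCoherentUnits hπ) (n : ℕ) :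
    colemanTrace hπ n β.logDeriv = PowerSeries.C (LTCoeff.of F π) * β.logDeriv :=
  colemanTrace_logDeriv_of_colemanNorm_eq hπ n (colemanUnit β)
    (by rw [coe_colemanUnit]; exact colemanNorm_colemanSeries_level hπ β n)

/-- **`δ(ββ') = δβ + δβ'`** (de Shalit I Lemma 3.4 (i)). [cite: deShalit1987, Ch. I §3.4 Lemma (i)] -/
theorem logDeriv_mul (β β' : NormCoherentUnits hπ) : (β.mul β').logDeriv = β.logDeriv + β'.logDeriv := by
  rw [logDeriv_def, colemanUnit_mul, GaloisRepresentations.logDeriv_mul, logDeriv_def, logDeriv_def]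

/-- `δ1 = 0`. [cite: deShalit1987, Ch. I §3.4 Lemma (i)] -/
theorem logDeriv_one : (one : NormCoherentUnits hπ).logDeriv = 0 := by
  rw [logDeriv_def, colemanUnit_one, GaloisRepresentations.logDeriv_one]

/-- ★ **`δ(σ_v β) = v · (δβ) ∘ [v]_f`** for `v ∈ 𝒪[F]ˣ` (from `g_{σ_v β} = g_β ∘ [v]_f`): the
`𝒪[F]ˣ`-semilinearity of `δ` (de Shalit I Lemma 3.4 (ii) / 3.5 (ii)). [cite: deShalit1987, Ch. I §3.4 Lemma (ii)] -/
theorem logDeriv_unitAct (v : 𝒪[F]ˣ) (β : NormCoherentUnits hπ) :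
    (β.unitAct v).logDeriv = PowerSeries.C (LTCoeff.of F (v : 𝒪[F])) *
      β.logDeriv.subst (hom (isLTRing_LTCoeff hπ) (isLTSeries_LTCoeff π) (isLTSeries_LTCoeff π)
        (LTCoeff.of F (v : 𝒪[F]))) :=
  logDeriv_eq_of_eq_subst_hom hπ (v : 𝒪[F]) (colemanUnit β) (colemanUnit (β.unitAct v))
    (by rw [coe_colemanUnit, coe_colemanUnit, colemanSeries_unitAct])

/-- ★ **`δ(σβ) = χ_π(σ) · (δβ) ∘ [χ_π(σ)]_f` for `σ ∈ Γ_F`** (`χ_π` the Lubin–Tate character).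
[cite: deShalit1987, Ch. I §3.4 Lemma (ii)] -/
theorem logDeriv_galAct (σ : Field.absoluteGaloisGroup F) (β : NormCoherentUnits hπ) :
    (β.galAct σ).logDeriv = PowerSeries.C (LTCoeff.of F (lubinTateChar hπ σ : 𝒪[F])) *
      β.logDeriv.subst (hom (isLTRing_LTCoeff hπ) (isLTSeries_LTCoeff π) (isLTSeries_LTCoeff π)
        (LTCoeff.of F (lubinTateChar hπ σ : 𝒪[F]))) := by
  rw [galAct_eq_unitAct]; exact logDeriv_unitAct _ β

/-- ★ **The kernel of `δ` on `𝒰`** (characteristic `0`): if `δβ = 0` then `g_β` is a constant `c` with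
`c^q = c`, and every component `β_m` is that root of unity `c ∈ μ_{q-1}(F)`.
[cite: deShalit1987, Ch. I §3.12 Corollary] -/
theorem exists_eq_algebraMap_of_logDeriv_eq_zero [CharZero F] (β : NormCoherentUnits hπ) (h : β.logDeriv = 0) :
    ∃ c : LTCoeff F, c ^ residueFieldCard F = c ∧ colemanSeries hπ β = PowerSeries.C c ∧
      ∀ m, β.val m = algebraMap (LTCoeff F) (unitBall (ltField π m)) c := by
  obtain ⟨hC, hq⟩ := eq_C_of_colemanNorm_eq_of_logDeriv_eq_zero hπ 0 (colemanUnit β)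
    (by rw [coe_colemanUnit]; exact colemanNorm_colemanSeries hπ β) h
  rw [coe_colemanUnit] at hC hq
  set c := PowerSeries.constantCoeff (colemanSeries hπ β) with hc
  refine ⟨c, hq, hC, fun m => ?_⟩
  rw [← evalAt_cohPt_colemanSeries hπ β m, hC, PowerSeries.C_eq_algebraMap, AlgHom.commutes]

end NormCoherentUnits

end LocalFieldLogDerivUnits

end Literature.NumberTheory.GaloisRepresentations
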